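import Summits.BirchSwinnertonDyer.BirchSwinnertonDyer.Theorems.ClassRecordThreeEulerHalvesAtThreeCartanTorusCubeCutCuspNorm
import Summits.BirchSwinnertonDyer.BirchSwinnertonDyer.Theorems.ClassRecordThreeEulerHalvesAtThreeCartanTorusCubeCutCuspGoodConjugate
import Summits.BirchSwinnertonDyer.BirchSwinnertonDyer.Theorems.ClassRecordThreeEulerHalvesAtThreeCartanTorusCubeCutPSModAssembly
import HarnessLib

/-!
# Crux 23422 `EulerHalvesAtThreeResidualUpperBound`, line `cartan` v9 — registered stub (F2a) `stub_cubicTorusPeriodRatioAtThreeGeFive`: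
# S-K1′ for `q ≥ 5`, `ord₃ [X^{T_s} : ℤ N_{T_s} w_C] + ord₃(q+1) = ord₃ [X^{C} : ℤ N_C w_s] + 1 + ord₃(q−1)`

Seat `bsd-stepL-tam3-p1` g21 (LINE OWNER of crux `stmt-BirchSwinnertonDyer-23422`; `--supports stmt-BirchSwinnertonDyer-23422`, stub
credit for the registered stub `stub_cubicTorusPeriodRatioAtThreeGeFive : CartanDegree.CubicTorusPeriodRatioAtThreeGeFive` of
`Cruxes/EulerHalvesAtThreeResidualUpperBound/Lines/cartan.lean` v9). The proof is bsd-idea-10 g11's torus-cube cut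
`CartanTorusCubeCut.cubicTorusPeriodRatioAtThreeGeFive_of` (RULING 91(b)) fed with its five inputs, all now tree theorems:
(C1) `cuspCubeNormFixed` (`…CuspNorm`), (C2) `cuspGoodConjugate` (`…CuspGoodConjugate`) — the cuspidal half, this seat — and
(P1) `PSMod.psNonsplitNormLower`, (P2) `PSMod.psSplitNormSharp`, (P3) `PSMod.psNonsplitNormSharp` (`…PSModAssembly`) — the principal-series
half: cartan-f2a g0's reductions to a mod-3 line `X_M` (`…PSLine*`, `…PSUnipotent`, `…PSCube`, `…PSModThree`) and this seat's construction
of `X_M = red⁻¹(range Φ̄)` from the Steinberg module (`…SteinbergSimple`, `…PSModPhantom`, `…PSModPhi`, `…PSModW`, `…PSModNormU`).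
HONEST FRAMING: (F2a) is a theorem of pure finite group theory (integral `GL₂(𝔽_q)`-lattices with the cubic-newvector character, primes
`q ≥ 5`); it is ONE of the three registered stubs of line `cartan` v9 — the crux `EulerHalvesAtThreeResidualUpperBound` (item 23422) is
NOT closed by it (stubs (F2⁰) `stub_cartanEmptyDegreeIndep` and (F2b♭) `stub_cartanHomLatticeDictionaryAtThreeVal` remain), no summit
statement and no route item is proved, and BSD is proved for no curve. [folklore]
-/

namespace Summit.BirchSwinnertonDyer.BirchSwinnertonDyer.Theorems.CartanTorusCubeCut

set_option linter.dupNamespace false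

/-- **(F2a) = S-K1′ for `q ≥ 5`** (registered stub of crux 23422, line `cartan` v9): for every prime `q ≥ 5`, every Cartan torus
lattice `𝓛` and generators `w_s`, `w_C` of the split / non-split torus fixed lines,
`ord₃ B(w_s,w_s) + ord₃(q+1) = ord₃ B(w_C,w_C) + 1 + ord₃(q−1)` — by the torus-cube cut from (C1), (C2), (P1), (P2), (P3). -/
theorem stub_cubicTorusPeriodRatioAtThreeGeFive : CartanDegree.CubicTorusPeriodRatioAtThreeGeFive :=
  cubicTorusPeriodRatioAtThreeGeFive_of cuspCubeNormFixed cuspGoodConjugate PSMod.psNonsplitNormLower PSMod.psSplitNormSharp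
    PSMod.psNonsplitNormSharp

end Summit.BirchSwinnertonDyer.BirchSwinnertonDyer.Theorems.CartanTorusCubeCut
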